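import Summits.BirchSwinnertonDyer.BirchSwinnertonDyer.Theorems.ResidualThetaTransportAtTwoThetaLayerLambdaCongruenceAtTwoStarIndexTwoGlue
import Literature.NumberTheory.EllipticCurves.EichlerShimuraOptimalQuotientLattice
import Literature.NumberTheory.EllipticCurves.RationalIsogenyDegrees
import Literature.NumberTheory.EllipticCurves.OrdinaryPrimesProofs
import Literature.NumberTheory.EllipticCurves.LFunctionPrimeCoeff
import HarnessLib

/-!
# Crux `ThetaLayerLambdaCongruenceAtTwo` (stmt-BirchSwinnertonDyer-20688, route ResidualThetaTransportAtTwo), line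
# `birth` v9, stub (C3k), plan ITEM B5 — ASSEMBLY FROM THE NAMED FACTS: complex conjugation is NOT the identity on
# `H₁(X₀(L), ℤ)/𝔪` at the `S`-depleted level of a curve `W` good supersingular at `2` with `Δ_W < 0` (width seat
# bsd-wall-rtt-p3-w3 g3; `--supports stmt-BirchSwinnertonDyer-20688 --as helper`; closes nothing)

HONEST FRAMING. A CONDITIONAL THEOREM: its named-fact hypotheses are
`eichlerShimura_depletedOptimalQuotient_periodLattice` (Literature, assembled from Shimura 1971 / Agashe–Ribet–Stein 2006 /
Knapp 1993; landed p599108), `WeierstrassCurve.isIsogenous_iff_frobeniusTrace_eq` (Faltings 1983) and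
`mazurKenku_exists_cyclic_isogeny` (Mazur 1978 / Kenku 1982); everything else is proved in the tree (the `…Star*` files of this
crux). It proves ITEM B5 of Lines/birth-C3k-plan.md, not (C3k) and not the crux; BSD is not proved by any of this.

WHAT (`exists_periodFunctional_iotaConj_add_notMem_of_facts`). For `W/ℚ` globally minimal with `GoodSS W 2` and `Δ_W < 0`, its
newform `f` (`IsNewformOf W f`, level `N`), a NONEMPTY finite set `S` of primes and `L = N·∏_{ℓ∈S} ℓ²`: there is the depleted
form `g ∈ S₂(Γ₀(L))` (`a_n(g) = 𝟙_{(n,S)=1} a_n(W)`, real, `a₁ = 1`, `T_p g = a_p(W) g` for `p ∉ S`, `U_ℓ g = 0` for `ℓ ∈ S`)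
such that for EVERY ideal `𝔪 ⊆ HeckeRing0 L 2` acting on `g` by even integers — e.g. `(2, T_p − a_p(W) (p ∉ S), T_ℓ (ℓ ∈ S))`
by `ideal_span_acts_even` — some `γ ∈ Γ₀(L)` has `{∞,(εγε)∞} + {∞,γ∞} ∉ 𝔪 • Λ` (and `− ` instead of `+` when `2 ∈ 𝔪`,
`…_sub_…`): the star involution is not the identity on `Λ/𝔪Λ`, `Λ = periodHomology L`. Proof: depleted form
(`…StarDepletedForm`) ⟶ optimal quotient `A`, `Λ_A = c·Λ_g` (fact) ⟶ `a_p(A) = a_p(g) = a_p(W)` off `S ∪ bad(W) ∪ finite` ⟶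
`W ~ A` (Faltings) ⟶ cyclic `ψ : W → A` (Mazur–Kenku) ⟶ `…StarAssembly.exists_periodFunctional_iotaConj_add_notMem_of_optimalQuotient`.
Also (`indexTwo_of_fourCosets_of_facts`, §2) the same data feed the (K2) glue of `…StarIndexTwoGlue`: with B4 in the shape
«`Λ/𝔪Λ` has at most the four cosets of `0, v₁, v₂, v₁+v₂`», every `K ⊇ 𝔪Λ +` cusp-negation differences has `[Λ : Λ ∩ K] ≤ 2`.

References: [ShimuraIATAF1971] Thm. 3.43, 7.14–7.15; [AgasheRibetStein2006] §2–3; [Knapp1993] Thm. 11.74; [Faltings1983Endlichkeit];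
[Mazur1978]; [Kenku1982]; [CremonaAlgorithms1997] §2.10.
-/

noncomputable section

-- justification: the `Summit.BirchSwinnertonDyer.BirchSwinnertonDyer.…` path repeats a component (route-file convention)
set_option linter.dupNamespace false

open scoped MatrixGroups ComplexConjugate ModularForm

open CongruenceSubgroup Complex WeierstrassCurve
open Literature.NumberTheory.EllipticCurves Literature.NumberTheory.EllipticCurves.ModularForms
open Literature.NumberTheory.EllipticCurves.Rank1Residual

namespace Summit.BirchSwinnertonDyer.BirchSwinnertonDyer.Theorems.ThetaLayerLambdaCongruenceAtTwo

/-! ## §1. ITEM B5 from the named facts -/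

/-- **ITEM B5 (conditional on three named facts).** `W/ℚ` globally minimal, good supersingular at `2`, `Δ_W < 0`, newform `f`
(`IsNewformOf W f`), `S ≠ ∅` a finite set of primes, `L = N·∏_{ℓ∈S} ℓ²`. Then the `S`-depleted form `g ∈ S₂(Γ₀(L))` of `f` exists
with the listed properties and, for every ideal `𝔪 ⊆ HeckeRing0 L 2` acting on `g` by even integers, complex conjugation is not
the identity on `Λ/𝔪Λ`: `∃ γ, {∞,(εγε)∞} + {∞,γ∞} ∉ 𝔪 • periodHomologyHecke L`. Named-fact inputs: the optimal quotient of the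
depleted form (`eichlerShimura_depletedOptimalQuotient_periodLattice`), Faltings (`isIsogenous_iff_frobeniusTrace_eq`),
Mazur–Kenku (`mazurKenku_exists_cyclic_isogeny`). [cite: CremonaAlgorithms1997, §2.10 (pp. 29–30)] -/
theorem exists_periodFunctional_iotaConj_add_notMem_of_facts
    (hES : eichlerShimura_depletedOptimalQuotient_periodLattice)
    (hF : isIsogenous_iff_frobeniusTrace_eq) (hMK : mazurKenku_exists_cyclic_isogeny)
    (W : WeierstrassCurve ℚ) [W.IsElliptic] [W.IsGloballyMinimal] (hss : GoodSS W 2) (hΔ : W.Δ < 0)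
    {N : ℕ} [NeZero N] {f : CuspForm (Gamma0 N) 2} (hf : IsNewformOf W f)
    (S : Finset ℕ) (hS : ∀ ℓ ∈ S, ℓ.Prime) (hSne : S.Nonempty) (L : ℕ) [NeZero L] (hL : L = N * ∏ ℓ ∈ S, ℓ ^ 2) :
    ∃ g : CuspForm (Gamma0 L) 2,
      (∀ n : ℕ, cuspCoeff g n = if ∃ ℓ ∈ S, ℓ ∣ n then 0 else (W.LFunction n : ℂ)) ∧
      (∀ n : ℕ, (cuspCoeff g n).im = 0) ∧ cuspCoeff g 1 = 1 ∧
      (∀ (p : ℕ) (hp : p.Prime), p ∉ S →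
        (haveI : NeZero p := ⟨hp.ne_zero⟩; heckeT (Gamma0 L) 2 p g) = (W.LFunction p : ℂ) • g) ∧
      (∀ (ℓ : ℕ) (hℓ : ℓ.Prime), ℓ ∈ S → (haveI : NeZero ℓ := ⟨hℓ.ne_zero⟩; heckeT (Gamma0 L) 2 ℓ g) = 0) ∧
      ∀ (𝔪 : Ideal (HeckeRing0 L 2)), (∀ t ∈ 𝔪, ∃ e : ℤ, HeckeRing0.toEnd L 2 t g = ((2 * e : ℤ) : ℂ) • g) →
        ∃ γ : Gamma0 L, periodFunctional L ⟨iotaConj (γ : SL(2, ℤ)), iotaConj_coe_mem_gamma0 γ⟩ +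
          periodFunctional L γ ∉ 𝔪 • periodHomologyHecke L := by
  classical
  obtain ⟨g, hg, hgi, hgr, hg1, hgT, hgU, hgall⟩ := exists_depleted_eigenform_of_isNewformOf W hf S hS L hL
  -- the depleted form in terms of `f`
  have hg' : ∀ n : ℕ, cuspCoeff g n = if ∃ ℓ ∈ S, ℓ ∣ n then 0 else cuspCoeff f n := fun n ↦ by
    rw [hg n, hf.2 n]
  have hint : ∀ n : ℕ, ∃ a : ℤ, cuspCoeff f n = a := fun n ↦ ⟨W.LFunction n, hf.2 n⟩
  -- the optimal quotient
  obtain ⟨A, hAell, hAmin, LA, c, hLA, hc, hlat, hfin⟩ := hES N f hf.1 hint S hS hSne L hL g hg'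
  -- `W ~ A`: the traces of Frobenius agree off a finite set
  have hiso : IsIsogenous W A := by
    refine (hF W A).mpr ?_
    set D : ℤ := W.minimalDiscriminantInt with hD
    have hD0 : D ≠ 0 := W.minimalDiscriminantInt_ne_zero
    refine ((Set.finite_Iic D.natAbs).union ((S : Set ℕ).toFinite.union hfin)).subset ?_
    rintro p ⟨hp, hne⟩
    by_contra hmem
    simp only [Set.mem_union, Set.mem_Iic, Finset.mem_coe, Set.mem_setOf_eq, not_or] at hmem
    obtain ⟨hpD, hpS, hpA⟩ := hmem
    haveI : Fact p.Prime := ⟨hp⟩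
    have hndvd : ¬ (p : ℤ) ∣ D := fun h ↦ hpD (Nat.le_of_dvd (Int.natAbs_pos.mpr hD0) (Int.ofNat_dvd_left.mp h))
    have hgood : W.HasGoodReductionAtPrime p := hasGoodReductionAtPrime_of_not_dvd W p hndvd
    have h1 : (W.LFunction p : ℂ) = ((W.frobeniusTrace p : ℤ) : ℂ) := by
      rw [LFunction_apply_prime_eq_frobeniusTrace W p hgood]
    have h2 : cuspCoeff g p = (W.LFunction p : ℂ) := by
      rw [hg p, if_neg]
      rintro ⟨ℓ, hℓ, hd⟩
      exact hpS (((Nat.prime_dvd_prime_iff_eq (hS ℓ hℓ) hp).mp hd) ▸ hℓ)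
    have h3 : ((A.frobeniusTrace p : ℤ) : ℂ) = cuspCoeff g p := by
      by_contra h; exact hpA ⟨hp, h⟩
    apply hne
    have : ((W.frobeniusTrace p : ℤ) : ℂ) = ((A.frobeniusTrace p : ℤ) : ℂ) := by rw [← h1, ← h2, h3]
    exact_mod_cast this
  -- a cyclic isogeny `W → A` (Mazur–Kenku)
  obtain ⟨ψ, hcyc, -⟩ := hMK W A hiso
  exact ⟨g, hg, hgr, hg1, hgT, hgU, fun 𝔪 h𝔪 ↦
    exists_periodFunctional_iotaConj_add_notMem_of_optimalQuotient W hss hΔ g hgr A hLA hc hlat ψ hcyc 𝔪 h𝔪⟩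


/-- **The `−` spelling with the explicit eigen-ideal.** Same hypotheses; for the ideal
`𝔪₀ = (2, T_p − a_p(W)·1 (p prime, p ∉ S), T_ℓ (ℓ ∈ S))` — more generally any ideal generated by `2` and elements
`T_p − b_p` with `T_p g = b_p g` — one has `2 ∈ 𝔪₀`, `𝔪₀` acts on `g` by even integers (`ideal_span_acts_even`), and some
`γ` has `{∞,(εγε)∞} − {∞,γ∞} ∉ 𝔪₀ • Λ`. Stated for an arbitrary ideal containing `2` and acting evenly.
[cite: CremonaAlgorithms1997, §2.10 (pp. 29–30)] -/
theorem exists_periodFunctional_iotaConj_sub_notMem_of_facts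
    (hES : eichlerShimura_depletedOptimalQuotient_periodLattice)
    (hF : isIsogenous_iff_frobeniusTrace_eq) (hMK : mazurKenku_exists_cyclic_isogeny)
    (W : WeierstrassCurve ℚ) [W.IsElliptic] [W.IsGloballyMinimal] (hss : GoodSS W 2) (hΔ : W.Δ < 0)
    {N : ℕ} [NeZero N] {f : CuspForm (Gamma0 N) 2} (hf : IsNewformOf W f)
    (S : Finset ℕ) (hS : ∀ ℓ ∈ S, ℓ.Prime) (hSne : S.Nonempty) (L : ℕ) [NeZero L] (hL : L = N * ∏ ℓ ∈ S, ℓ ^ 2) :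
    ∃ g : CuspForm (Gamma0 L) 2,
      (∀ n : ℕ, cuspCoeff g n = if ∃ ℓ ∈ S, ℓ ∣ n then 0 else (W.LFunction n : ℂ)) ∧
      (∀ (p : ℕ) (hp : p.Prime), (haveI : NeZero p := ⟨hp.ne_zero⟩; heckeT (Gamma0 L) 2 p g) = cuspCoeff g p • g) ∧
      ∀ (𝔪 : Ideal (HeckeRing0 L 2)), (2 : HeckeRing0 L 2) ∈ 𝔪 →
        (∀ t ∈ 𝔪, ∃ e : ℤ, HeckeRing0.toEnd L 2 t g = ((2 * e : ℤ) : ℂ) • g) →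
        ∃ γ : Gamma0 L, periodFunctional L ⟨iotaConj (γ : SL(2, ℤ)), iotaConj_coe_mem_gamma0 γ⟩ -
          periodFunctional L γ ∉ 𝔪 • periodHomologyHecke L := by
  obtain ⟨g, hg, hgr, hg1, hgT, hgU, hB5⟩ :=
    exists_periodFunctional_iotaConj_add_notMem_of_facts hES hF hMK W hss hΔ hf S hS hSne L hL
  -- `T_p g = a_p(g) g` for every prime (from the two Hecke clauses and the coefficient formula)
  have hall : ∀ (p : ℕ) (hp : p.Prime), (haveI : NeZero p := ⟨hp.ne_zero⟩; heckeT (Gamma0 L) 2 p g) = cuspCoeff g p • g := by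
    intro p hp
    by_cases hpS : p ∈ S
    · rw [hgU p hp hpS, hg p, if_pos ⟨p, hpS, dvd_rfl⟩, zero_smul]
    · rw [hgT p hp hpS, hg p, if_neg]
      rintro ⟨ℓ, hℓ, hd⟩
      exact hpS (((Nat.prime_dvd_prime_iff_eq (hS ℓ hℓ) hp).mp hd) ▸ hℓ)
  refine ⟨g, hg, hall, fun 𝔪 h2 h𝔪 ↦ ?_⟩
  obtain ⟨γ, hγ⟩ := hB5 𝔪 h𝔪
  refine ⟨γ, fun hmem ↦ hγ ?_⟩
  have h2γ : (2 : HeckeRing0 L 2) • periodFunctional L γ ∈ 𝔪 • periodHomologyHecke L :=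
    Submodule.smul_mem_smul h2 ((mem_periodHomologyHecke L).mpr (periodFunctional_mem_periodHomology L γ))
  have e : periodFunctional L ⟨iotaConj (γ : SL(2, ℤ)), iotaConj_coe_mem_gamma0 γ⟩ + periodFunctional L γ =
      (periodFunctional L ⟨iotaConj (γ : SL(2, ℤ)), iotaConj_coe_mem_gamma0 γ⟩ - periodFunctional L γ) +
        (2 : HeckeRing0 L 2) • periodFunctional L γ := by
    rw [show (2 : HeckeRing0 L 2) = (2 : ℕ) • (1 : HeckeRing0 L 2) by norm_num, smul_assoc, one_smul, two_nsmul]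
    abel
  rw [e]
  exact add_mem hmem h2γ

/-! ## §2. (K2) from the named facts and the four-cosets form of B4 -/

/-- **B4 ∧ (facts) ⇒ (K2).** With the hypotheses of `exists_periodFunctional_iotaConj_add_notMem_of_facts`, the depleted form
`g` (any cusp form with the depleted `q`-expansion — it is unique) and an ideal `𝔪 ∋ 2` acting on `g` by even integers: if
`Λ/𝔪Λ` has at most the four cosets of `0, v₁, v₂, v₁+v₂` (`v₂ ∈ Λ`; mod-`2` multiplicity one, quotient form), then every
subgroup `K` of `S₂(Γ₀(L))^∨` containing `𝔪 • Λ` and all `{∞,(εγε)∞} − {∞,γ∞}` satisfies `x, y ∈ Λ ∖ K ⇒ x − y ∈ K`.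
[cite: CremonaAlgorithms1997, §2.10 (pp. 29–30)] -/
theorem indexTwo_of_fourCosets_of_facts
    (hES : eichlerShimura_depletedOptimalQuotient_periodLattice)
    (hF : isIsogenous_iff_frobeniusTrace_eq) (hMK : mazurKenku_exists_cyclic_isogeny)
    (W : WeierstrassCurve ℚ) [W.IsElliptic] [W.IsGloballyMinimal] (hss : GoodSS W 2) (hΔ : W.Δ < 0)
    {N : ℕ} [NeZero N] {f : CuspForm (Gamma0 N) 2} (hf : IsNewformOf W f)
    (S : Finset ℕ) (hS : ∀ ℓ ∈ S, ℓ.Prime) (hSne : S.Nonempty) (L : ℕ) [NeZero L] (hL : L = N * ∏ ℓ ∈ S, ℓ ^ 2)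
    (g : CuspForm (Gamma0 L) 2) (hg : ∀ n : ℕ, cuspCoeff g n = if ∃ ℓ ∈ S, ℓ ∣ n then 0 else (W.LFunction n : ℂ))
    (𝔪 : Ideal (HeckeRing0 L 2)) (h2 : (2 : HeckeRing0 L 2) ∈ 𝔪)
    (h𝔪 : ∀ t ∈ 𝔪, ∃ e : ℤ, HeckeRing0.toEnd L 2 t g = ((2 * e : ℤ) : ℂ) • g)
    (K : AddSubgroup (Module.Dual ℂ (CuspForm (Gamma0 L) 2)))
    (hK𝔪 : ∀ x ∈ 𝔪 • periodHomologyHecke L, x ∈ K)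
    (hKc : ∀ γ : Gamma0 L, periodFunctional L ⟨iotaConj (γ : SL(2, ℤ)), iotaConj_coe_mem_gamma0 γ⟩ - periodFunctional L γ ∈ K)
    {v₁ v₂ : Module.Dual ℂ (CuspForm (Gamma0 L) 2)} (hv₂ : v₂ ∈ periodHomology L)
    (hcos : ∀ x ∈ periodHomology L, x ∈ 𝔪 • periodHomologyHecke L ∨ x - v₁ ∈ 𝔪 • periodHomologyHecke L ∨
      x - v₂ ∈ 𝔪 • periodHomologyHecke L ∨ x - (v₁ + v₂) ∈ 𝔪 • periodHomologyHecke L)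
    {x y : Module.Dual ℂ (CuspForm (Gamma0 L) 2)} (hx : x ∈ periodHomology L) (hy : y ∈ periodHomology L)
    (hxK : x ∉ K) (hyK : y ∉ K) : x - y ∈ K := by
  classical
  -- identify `g` with the depleted form of `…_of_facts` (same `q`-expansion) and rerun the data chain
  have hreal : ∀ n, (cuspCoeff g n).im = 0 := fun n ↦ by
    rw [hg n]; split_ifs <;> simp
  have hg' : ∀ n : ℕ, cuspCoeff g n = if ∃ ℓ ∈ S, ℓ ∣ n then 0 else cuspCoeff f n := fun n ↦ by rw [hg n, hf.2 n]
  have hint : ∀ n : ℕ, ∃ a : ℤ, cuspCoeff f n = a := fun n ↦ ⟨W.LFunction n, hf.2 n⟩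
  obtain ⟨A, hAell, hAmin, LA, c, hLA, hc, hlat, hfin⟩ := hES N f hf.1 hint S hS hSne L hL g hg'
  have hiso : IsIsogenous W A := by
    refine (hF W A).mpr ?_
    set D : ℤ := W.minimalDiscriminantInt with hD
    have hD0 : D ≠ 0 := W.minimalDiscriminantInt_ne_zero
    refine ((Set.finite_Iic D.natAbs).union ((S : Set ℕ).toFinite.union hfin)).subset ?_
    rintro p ⟨hp, hne⟩
    by_contra hmem
    simp only [Set.mem_union, Set.mem_Iic, Finset.mem_coe, Set.mem_setOf_eq, not_or] at hmem
    obtain ⟨hpD, hpS, hpA⟩ := hmem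
    haveI : Fact p.Prime := ⟨hp⟩
    have hndvd : ¬ (p : ℤ) ∣ D := fun h ↦ hpD (Nat.le_of_dvd (Int.natAbs_pos.mpr hD0) (Int.ofNat_dvd_left.mp h))
    have hgood : W.HasGoodReductionAtPrime p := hasGoodReductionAtPrime_of_not_dvd W p hndvd
    have h1 : (W.LFunction p : ℂ) = ((W.frobeniusTrace p : ℤ) : ℂ) := by
      rw [LFunction_apply_prime_eq_frobeniusTrace W p hgood]
    have h2' : cuspCoeff g p = (W.LFunction p : ℂ) := by
      rw [hg p, if_neg]
      rintro ⟨ℓ, hℓ, hd⟩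
      exact hpS (((Nat.prime_dvd_prime_iff_eq (hS ℓ hℓ) hp).mp hd) ▸ hℓ)
    have h3 : ((A.frobeniusTrace p : ℤ) : ℂ) = cuspCoeff g p := by
      by_contra h; exact hpA ⟨hp, h⟩
    apply hne
    have : ((W.frobeniusTrace p : ℤ) : ℂ) = ((A.frobeniusTrace p : ℤ) : ℂ) := by rw [← h1, ← h2', h3]
    exact_mod_cast this
  obtain ⟨ψ, hcyc, -⟩ := hMK W A hiso
  exact indexTwo_of_fourCosets_of_optimalQuotient W hss hΔ g hreal A hLA hc hlat ψ hcyc 𝔪 h2 h𝔪 K hK𝔪 hKc hv₂ hcos hx hy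
    hxK hyK

end Summit.BirchSwinnertonDyer.BirchSwinnertonDyer.Theorems.ThetaLayerLambdaCongruenceAtTwo

end
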